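import Literature.Analysis.FluidPDE.FluidComputer.ThresholdLevelTable
import HarnessLib

/-!
# Kernel run of the level-table checker, chunks 0 … 3 (steps 0 … 99) (bp3 gen 13, layer 4)

HONEST FRAMING: low prior, high value-of-information experiment on Tao's machine paradigm; NOT a
claim that NS blows up.

Four kernel evaluations (`decide +kernel`; no `native_decide`, no extra axioms): the checker
`runSteps` of `ThresholdLevelCheck.lean` (crude box, `K = 3` refinement passes, side and runtime
conditions, reach, speed, exit box — all in the dyadic interval arithmetic `DI` at `P = 60` with
`12` Taylor terms) runs 25 steps of `ThresholdLevelTable.stepsT` at a time, from the entry box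
`Bc i` towards the next chunk's first level, and returns the entry box `Bc (i+1)` (≈ 30 s of
kernel time and bounded memory per chunk; 100-step chunks exceed the kernel's memory bound).
-/

namespace Literature.Analysis.FluidPDE.FluidComputer

namespace ThresholdLevelTable

set_option maxHeartbeats 10000000 in
set_option maxRecDepth 200000 in
/-- Chunk 0 of the table run (steps 0 … 24). [folklore] -/
theorem run0 : runSteps 60 12 3 GIt RbIt Bc0 chunk0 560258274993937 = some Bc1 := by
  decide +kernel

set_option maxHeartbeats 10000000 in
set_option maxRecDepth 200000 in
/-- Chunk 1 of the table run (steps 25 … 49). [folklore] -/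
theorem run1 : runSteps 60 12 3 GIt RbIt Bc1 chunk1 666799089894214 = some Bc2 := by
  decide +kernel

set_option maxHeartbeats 10000000 in
set_option maxRecDepth 200000 in
/-- Chunk 2 of the table run (steps 50 … 74). [folklore] -/
theorem run2 : runSteps 60 12 3 GIt RbIt Bc2 chunk2 793600105752233 = some Bc3 := by
  decide +kernel

set_option maxHeartbeats 10000000 in
set_option maxRecDepth 200000 in
/-- Chunk 3 of the table run (steps 75 … 99). [folklore] -/
theorem run3 : runSteps 60 12 3 GIt RbIt Bc3 chunk3 944514078370851 = some Bc4 := by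
  decide +kernel

end ThresholdLevelTable

end Literature.Analysis.FluidPDE.FluidComputer
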